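import Literature.NumberTheory.LFunctions.ZetaZeroSumsPsiWeightLow
import HarnessLib

/-!
# RH-FREE — Fiori–Kadiri–Swidinsky 2023, Proposition 3.8: the middle part `Σ_{σ₁}^{σ₂} = 2Σ_{0<γ<T, σ₁≤β<σ₂} x^{β−1}/γ ≤ ε₃(x,σ₁,σ₂,N,T)` of the zero sum for `ψ` («nothing here bears on the truth of RH»)

Topic `Literature/NumberTheory/LFunctions` (RH literature-typing tranche 1, L4 "explicit zero
statistics", gen 5). Label **RH-FREE**. Three definitions (the printed `σ^{(n)}`, `H_σ`, `ε₃`) and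
THEOREMS; no named facts. Nothing here bears on the truth of RH.

Fiori–Kadiri–Swidinsky, J. Math. Anal. Appl. 527 (2023) 127426 (arXiv:2204.02588v3; item and equation
numbers below are those of the compiled arXiv v3, audited 2026-08-27 — theorem-like items share one
counter, so this is **Proposition 3.8**; the declaration name `…_prop33` keeps the label of an earlier
miscount), §3.4, **Proposition 3.8** (PROVED here, `FioriKadiriSwidinsky2023_prop33`): with `σ^{(n)} = σ₁ + (σ₂−σ₁)n/N`
(3.14), `H_σ = max(H₀, exp(1/(R(1−σ))))` (3.12), `H^{(n)} = H_{σ^{(n)}}` (3.15), for `5/8 ≤ σ₁ < σ₂ ≤ 1`,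
`N ≥ 2`, `T ≥ H₀`, `x ≥ 1`,

  `Σ_{σ₁}^{σ₂} ≤ ε₃(x,σ₁,σ₂,N,T) = 2x^{−(1−σ₁)+(σ₂−σ₁)/N} B₀(σ₁, H_{σ₁}, T)
      + 2x^{−(1−σ₁)}(1 − x^{−(σ₂−σ₁)/N}) Σ_{n=1}^{N−1} B₀(σ^{(n)}, H^{(n)}, T) x^{(σ₂−σ₁)(n+1)/N}`

(`FKS2023.ε₃`, eq. (3.17)), given a (ZDB) majorant `N(σ,T) ≤ c₁(σ)T^{p(σ)}(log T)^{q(σ)} + c₂(σ)log²T`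
(`T ≥ H₀`, `0 < p < 1`, `q > 0`) on `[σ₁, σ₂]` — e.g. Cor. 2.9 with its table (the tree's `FioriKadiriSwidinsky2023_table6`) — and a classical zero-free
region `σ ≥ 1 − 1/(R log|t|)`, `|t| ≥ 2` (e.g. the tree's `zero_free_region_mossinghoff_trudgian_yang`,
`R = 5.558691`; FKS use `R = 5.5666305`), plus the numerical-RH fact (zeros with `β > ½` have
`γ > H₀`). Proof as printed: split `[σ₁, σ₂)` at the `σ^{(n)}`, bound `x^{β−1} ≤ x^{σ^{(n+1)}−1}` on the
`n`-th slab, rearrange by layers (the printed telescoping), and bound each layer sum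
`Σ_{β ≥ σ^{(k)}, H^{(k)}<γ≤T} m(ρ)/γ = s₀(σ^{(k)}, H^{(k)}, T)` by Lemma 2.5 (`sum_inv_le_B₀_of_countRe`):
the zeros with `β ≥ σ^{(k)}` have `γ > H^{(k)}` by the zero-free region and the RH verification.

SCOPE NOTE (made explicit in Lean, implicit in print): the bound is used — and stated here — for
`T ≥ H^{(n)}` for every `n < N`; for `T < H^{(n)}` the `n`-th slab is empty but the printed
`B₀(σ^{(n)}, H^{(n)}, T)` can be negative, so the printed right-hand side needs this reading.

## References

* A. Fiori, H. Kadiri, J. Swidinsky, J. Math. Anal. Appl. 527 (2023) 127426 (arXiv:2204.02588v3),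
  §3.4 eqs. (3.12), (3.14), (3.15), (3.17), Proposition 3.8. [FioriKadiriSwidinsky2023]
* M. J. Mossinghoff, T. S. Trudgian, A. Yang, Res. Number Theory 10 (2024), Thm. 1 (the tree's
  `zero_free_region_mossinghoff_trudgian_yang`). [MossinghoffTrudgianYangRNT2024]
-/

noncomputable section

open Complex Filter Set
open scoped Real

namespace Literature.NumberTheory.LFunctions

open SchoenfeldBound

namespace FKS2023

/-- The partition points `σ^{(n)} = σ₁ + (σ₂ − σ₁) n/N` (eq. (3.14)). [cite: FioriKadiriSwidinsky2023, §3.4 eq. (3.14)] -/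
def sigmaStep (σ₁ σ₂ : ℝ) (N n : ℕ) : ℝ := σ₁ + (σ₂ - σ₁) * n / N

/-- The heights `H_σ = max(H₀, exp(1/(R(1−σ))))` below which there are no zeros with `β ≥ σ`
(eq. (3.12); `H^{(n)} = H_{σ^{(n)}}`, eq. (3.15)). [cite: FioriKadiriSwidinsky2023, §3.4 eqs. (3.12), (3.15)] -/
def zfrHeight (R σ : ℝ) : ℝ := max H₀ (Real.exp (1 / (R * (1 - σ))))

/-- **`ε₃(x, σ₁, σ₂, N, T)`** of eq. (3.17), for a (ZDB) majorant with coefficient functions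
`c₁, c₂, p, q` and zero-free-region constant `R`:
`2x^{−(1−σ₁)+(σ₂−σ₁)/N} B₀(σ₁,H_{σ₁},T) + 2x^{−(1−σ₁)}(1 − x^{−(σ₂−σ₁)/N}) Σ_{n=1}^{N−1} B₀(σ^{(n)},H^{(n)},T) x^{(σ₂−σ₁)(n+1)/N}`.
[cite: FioriKadiriSwidinsky2023, Prop. 3.8 eq. (3.17)] -/
def ε₃ (c₁ c₂ p q : ℝ → ℝ) (R x σ₁ σ₂ : ℝ) (N : ℕ) (T : ℝ) : ℝ :=
  2 * x ^ (-(1 - σ₁) + (σ₂ - σ₁) / N) *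
      B₀ (c₁ σ₁) (c₂ σ₁) (p σ₁) (q σ₁) (zfrHeight R σ₁) T
    + 2 * x ^ (-(1 - σ₁)) * (1 - x ^ (-((σ₂ - σ₁) / N))) *
      ∑ n ∈ Finset.Ico 1 N,
        B₀ (c₁ (sigmaStep σ₁ σ₂ N n)) (c₂ (sigmaStep σ₁ σ₂ N n)) (p (sigmaStep σ₁ σ₂ N n))
            (q (sigmaStep σ₁ σ₂ N n)) (zfrHeight R (sigmaStep σ₁ σ₂ N n)) T
          * x ^ ((σ₂ - σ₁) * (n + 1) / N)

end FKS2023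

/-! ## Where the zeros with `β ≥ σ` are -/

/-- **A zero with `β ≥ σ > ½` has `γ > H_σ`** (`σ < 1`): `γ > 3 000 175 332 800 ≥ H₀` by the RH
verification, and `β < 1 − 1/(R log γ)` by the zero-free region, i.e. `γ > exp(1/(R(1−σ)))`.
[cite: FioriKadiriSwidinsky2023, §3.4 eq. (3.12) ("defined so that N(σ, H_σ) = 0")] -/
theorem FKS2023.zfrHeight_lt_im (hRH : platt_trudgian_numerical_rh) {R : ℝ} (hR : 0 < R)
    (hZFR : ∀ σ t : ℝ, 2 ≤ |t| → 1 - 1 / (R * Real.log |t|) ≤ σ → riemannZeta (σ + t * I) ≠ 0)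
    {σ : ℝ} (hσ : 1 / 2 < σ) (hσ1 : σ < 1) {ρ : ℂ} (hz : riemannZeta ρ = 0) (him : 0 < ρ.im)
    (hre : σ ≤ ρ.re) : FKS2023.zfrHeight R σ < ρ.im := by
  have hH₀ : FKS2023.H₀ = 3 * 10 ^ 12 := rfl
  -- RH verification
  have hγ : 3000175332800 < ρ.im := by
    by_contra hle
    have := hRH ρ hz him (not_lt.1 hle)
    linarith
  have hγ2 : 2 ≤ |ρ.im| := by rw [abs_of_pos him]; linarith
  have hlog : 0 < Real.log ρ.im := Real.log_pos (by linarith)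
  -- zero-free region: β < 1 − 1/(R log γ)
  have hβ : ρ.re < 1 - 1 / (R * Real.log ρ.im) := by
    by_contra hge
    have h := hZFR ρ.re ρ.im hγ2 (by rw [abs_of_pos him]; exact not_lt.1 hge)
    exact h (by rw [Complex.re_add_im]; exact hz)
  have h1 : 1 / (R * Real.log ρ.im) < 1 - σ := by linarith
  have h2 : 1 / (R * (1 - σ)) < Real.log ρ.im := by
    rw [div_lt_iff₀ (by nlinarith)]
    rw [div_lt_iff₀ (by positivity)] at h1
    nlinarith
  have hexp : Real.exp (1 / (R * (1 - σ))) < ρ.im := by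
    calc Real.exp (1 / (R * (1 - σ))) < Real.exp (Real.log ρ.im) := Real.exp_lt_exp.2 h2
      _ = ρ.im := Real.exp_log (by linarith)
  unfold FKS2023.zfrHeight
  refine max_lt ?_ hexp
  rw [hH₀]; linarith

/-! ## The staircase bound on the weights -/

/-- On `[σ₁, σ₂)` the weight `x^{β−1}` (`x ≥ 1`) is bounded by the staircase
`x^{σ^{(1)}−1} + Σ_{1≤k<N, σ^{(k)} ≤ β} (x^{σ^{(k+1)}−1} − x^{σ^{(k)}−1}) = x^{σ^{(n+1)}−1}` on the slab
`σ^{(n)} ≤ β < σ^{(n+1)}` (the printed "use `x^{β−1} < x^{σ^{(n+1)}−1}` on each section", rearranged).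
[cite: FioriKadiriSwidinsky2023, Prop. 3.8 (proof)] -/
theorem FKS2023.rpow_le_staircase {σ₁ σ₂ x β : ℝ} {N : ℕ} (hN : 1 ≤ N) (h12 : σ₁ < σ₂) (hx : 1 ≤ x)
    (hβ1 : σ₁ ≤ β) (hβ2 : β < σ₂) :
    x ^ (β - 1) ≤ x ^ (FKS2023.sigmaStep σ₁ σ₂ N 1 - 1) +
      ∑ k ∈ Finset.Ico 1 N, (if FKS2023.sigmaStep σ₁ σ₂ N k ≤ β then
        x ^ (FKS2023.sigmaStep σ₁ σ₂ N (k + 1) - 1) - x ^ (FKS2023.sigmaStep σ₁ σ₂ N k - 1) else 0) := by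
  classical
  have hNpos : (0 : ℝ) < N := by exact_mod_cast hN
  have hd : 0 < σ₂ - σ₁ := by linarith
  -- the slab index n = ⌊(β − σ₁) N/(σ₂ − σ₁)⌋
  set u : ℝ := (β - σ₁) * N / (σ₂ - σ₁) with hu
  have hu0 : 0 ≤ u := by rw [hu]; positivity
  have huN : u < N := by
    rw [hu, div_lt_iff₀ hd]; nlinarith
  set n : ℕ := Nat.floor u with hn
  have hn_le : (n : ℝ) ≤ u := Nat.floor_le hu0
  have hn_lt : u < n + 1 := Nat.lt_floor_add_one u
  have hnN : n < N := by
    have : (n : ℝ) < N := hn_le.trans_lt huN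
    exact_mod_cast this
  -- σ^{(k)} ≤ β ↔ k ≤ n, for natural k
  have hstep : ∀ k : ℕ, FKS2023.sigmaStep σ₁ σ₂ N k ≤ β ↔ k ≤ n := by
    intro k
    have e : FKS2023.sigmaStep σ₁ σ₂ N k ≤ β ↔ (k : ℝ) ≤ u := by
      unfold FKS2023.sigmaStep
      rw [hu, le_div_iff₀ hd]
      constructor
      · intro h
        have : (σ₂ - σ₁) * k / N ≤ β - σ₁ := by linarith
        rw [div_le_iff₀ hNpos] at this; linarith
      · intro h
        have : (σ₂ - σ₁) * k / N ≤ β - σ₁ := by rw [div_le_iff₀ hNpos]; linarith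
        linarith
    rw [e]
    constructor
    · intro h; exact_mod_cast Nat.le_floor h
    · intro h; exact (Nat.cast_le.2 h).trans hn_le
  -- the sum telescopes over k ∈ [1, n]
  set a : ℕ → ℝ := fun k ↦ x ^ (FKS2023.sigmaStep σ₁ σ₂ N k - 1) with ha
  have hsum : ∑ k ∈ Finset.Ico 1 N, (if FKS2023.sigmaStep σ₁ σ₂ N k ≤ β then a (k + 1) - a k else 0)
      = ∑ k ∈ Finset.Ico 1 (n + 1), (a (k + 1) - a k) := by
    rw [← Finset.sum_filter]
    congr 1
    ext k
    simp only [Finset.mem_filter, Finset.mem_Ico, hstep]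
    omega
  have htel : ∑ k ∈ Finset.Ico 1 (n + 1), (a (k + 1) - a k) = a (n + 1) - a 1 := by
    induction n with
    | zero => simp
    | succ m ih =>
      rw [Finset.sum_Ico_succ_top (by omega), ih]
      ring
  -- β < σ^{(n+1)}
  have hβn : β < FKS2023.sigmaStep σ₁ σ₂ N (n + 1) := by
    by_contra hge
    have := (hstep (n + 1)).1 (not_lt.1 hge)
    omega
  have hle : x ^ (β - 1) ≤ a (n + 1) := by
    simp only [ha]
    exact Real.rpow_le_rpow_of_exponent_le hx (by linarith)
  change x ^ (β - 1) ≤ a 1 + ∑ k ∈ Finset.Ico 1 N,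
    (if FKS2023.sigmaStep σ₁ σ₂ N k ≤ β then a (k + 1) - a k else 0)
  rw [hsum, htel]
  linarith

/-! ## Proposition 3.8 -/

/-- **FKS Proposition 3.8** (PROVED): let `5/8 ≤ σ₁ < σ₂ ≤ 1`, `N ≥ 2`, `x ≥ 1`; assume the
numerical-RH fact, a zero-free region `ζ(σ+it) ≠ 0` for `|t| ≥ 2`, `σ ≥ 1 − 1/(R log|t|)` (`R > 0`),
and a (ZDB) majorant `N(σ,T') ≤ c₁(σ) T'^{p(σ)} (log T')^{q(σ)} + c₂(σ) log² T'` for `T' ≥ H₀ = 3·10¹²`,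
`0 < p(σ) < 1`, `q(σ) > 0`, for every `σ ∈ [σ₁, σ₂]`. Then for every `T` with `T ≥ H^{(n)}` for all
`n < N` (in particular `T ≥ H₀`; see the module docstring's scope note),
`Σ_{σ₁}^{σ₂}(x,T) = 2Σ_{0<γ≤T, σ₁≤β<σ₂} m(ρ) x^{β−1}/γ ≤ ε₃(x,σ₁,σ₂,N,T)`.
[cite: FioriKadiriSwidinsky2023, Prop. 3.8] -/
theorem FioriKadiriSwidinsky2023_prop33 (hRH : platt_trudgian_numerical_rh) {R : ℝ} (hR : 0 < R)
    (hZFR : ∀ σ t : ℝ, 2 ≤ |t| → 1 - 1 / (R * Real.log |t|) ≤ σ → riemannZeta (σ + t * I) ≠ 0)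
    {c₁ c₂ p q : ℝ → ℝ} {σ₁ σ₂ : ℝ} (h58 : 5 / 8 ≤ σ₁) (h12 : σ₁ < σ₂) (hσ₂ : σ₂ ≤ 1)
    (hpq : ∀ σ ∈ Icc σ₁ σ₂, 0 < p σ ∧ p σ < 1 ∧ 0 < q σ)
    (hN : ∀ σ ∈ Icc σ₁ σ₂, ∀ T' : ℝ, FKS2023.H₀ ≤ T' →
      (zetaZeroCountRe σ T' : ℝ) ≤ FKS2023.zdbMajorant (c₁ σ) (c₂ σ) (p σ) (q σ) T')
    {N : ℕ} (hN2 : 2 ≤ N) {x T : ℝ} (hx : 1 ≤ x)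
    (hT : ∀ n < N, FKS2023.zfrHeight R (FKS2023.sigmaStep σ₁ σ₂ N n) ≤ T) :
    FKS2023.zeroSumPsi σ₁ σ₂ x T ≤ FKS2023.ε₃ c₁ c₂ p q R x σ₁ σ₂ N T := by
  classical
  have hN1 : 1 ≤ N := by omega
  have hNpos : (0 : ℝ) < N := by exact_mod_cast hN1
  have hx0 : 0 < x := by linarith
  have hH2 : (2 : ℝ) ≤ FKS2023.H₀ := by norm_num [FKS2023.H₀]
  set Z := zerosBetween 0 T with hZ
  set S := Z.filter (fun ρ ↦ σ₁ ≤ ρ.re ∧ ρ.re < σ₂) with hS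
  set w : ℂ → ℝ := fun ρ ↦ (riemannZetaZeroOrder ρ : ℝ) * (1 / ρ.im) with hw
  set σs : ℕ → ℝ := fun k ↦ FKS2023.sigmaStep σ₁ σ₂ N k with hσs
  set a : ℕ → ℝ := fun k ↦ x ^ (σs k - 1) with ha
  set Bk : ℕ → ℝ := fun k ↦ FKS2023.B₀ (c₁ (σs k)) (c₂ (σs k)) (p (σs k)) (q (σs k))
    (FKS2023.zfrHeight R (σs k)) T with hBk
  -- the partition points lie in [σ₁, σ₂] for k ≤ N, increase with k
  have hσs_val : ∀ k : ℕ, σs k = σ₁ + (σ₂ - σ₁) * k / N := fun k ↦ rfl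
  have hσs_mem : ∀ k : ℕ, k ≤ N → σs k ∈ Icc σ₁ σ₂ := by
    intro k hk
    rw [hσs_val]
    have hkN : (k : ℝ) ≤ N := by exact_mod_cast hk
    constructor
    · have : 0 ≤ (σ₂ - σ₁) * k / N := by positivity
      linarith
    · have : (σ₂ - σ₁) * k / N ≤ σ₂ - σ₁ := by
        rw [div_le_iff₀ hNpos]; nlinarith
      linarith
  have hσs_lt_one : ∀ k : ℕ, k < N → σs k < 1 := by
    intro k hk
    rw [hσs_val]
    have hkN : (k : ℝ) + 1 ≤ N := by exact_mod_cast hk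
    have : (σ₂ - σ₁) * k / N < σ₂ - σ₁ := by
      rw [div_lt_iff₀ hNpos]; nlinarith
    linarith
  have ha_mono : ∀ k : ℕ, a k ≤ a (k + 1) := by
    intro k
    simp only [ha, hσs_val]
    refine Real.rpow_le_rpow_of_exponent_le hx ?_
    have : (σ₂ - σ₁) * k / N ≤ (σ₂ - σ₁) * (k + 1 : ℕ) / N := by
      push_cast
      apply div_le_div_of_nonneg_right _ hNpos.le
      nlinarith
    linarith
  -- weights are non-negative on Z
  have hw0 : ∀ ρ ∈ Z, 0 ≤ w ρ := by
    intro ρ hρ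
    have hm := zeroOrder_nonneg_of_mem_zerosBetween le_rfl hρ
    obtain ⟨-, -, -, h3, -⟩ := (mem_zerosBetween le_rfl).1 hρ
    simp only [hw]; positivity
  -- the layer sums: zeros of Z with β ≥ σs k lie in the window (H^{(k)}, T] with β ≥ σs k
  have hlayer : ∀ k : ℕ, k < N →
      ∑ ρ ∈ S.filter (fun ρ ↦ σs k ≤ ρ.re), w ρ ≤ Bk k := by
    intro k hk
    have hmem := hσs_mem k hk.le
    obtain ⟨hp0, hp1, hq0⟩ := hpq (σs k) hmem
    have hsub : S.filter (fun ρ ↦ σs k ≤ ρ.re) ⊆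
        zerosBetweenRe (σs k) (FKS2023.zfrHeight R (σs k)) T := by
      intro ρ hρ
      rw [Finset.mem_filter, hS, Finset.mem_filter, hZ, mem_zerosBetween le_rfl] at hρ
      obtain ⟨⟨⟨hz, h0, h1, him, hT'⟩, -, hlt2⟩, hk'⟩ := hρ
      have hH0 : (0 : ℝ) ≤ FKS2023.zfrHeight R (σs k) :=
        le_trans (by norm_num [FKS2023.H₀]) (le_max_left _ _)
      refine (mem_zerosBetweenRe hH0).2 ⟨hz, hk', h1, ?_, hT'⟩
      exact FKS2023.zfrHeight_lt_im hRH hR hZFR (by linarith [hmem.1]) (hσs_lt_one k hk) hz him hk'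
    have hU : FKS2023.H₀ ≤ FKS2023.zfrHeight R (σs k) := le_max_left _ _
    have hU0 : 0 ≤ FKS2023.zfrHeight R (σs k) := le_trans (by norm_num [FKS2023.H₀]) hU
    calc ∑ ρ ∈ S.filter (fun ρ ↦ σs k ≤ ρ.re), w ρ
        ≤ ∑ ρ ∈ zerosBetweenRe (σs k) (FKS2023.zfrHeight R (σs k)) T, w ρ := by
          refine Finset.sum_le_sum_of_subset_of_nonneg hsub fun ρ hρ _ ↦ ?_
          obtain ⟨hz, -, -, h3, -⟩ := (mem_zerosBetweenRe hU0).1 hρ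
          have hm : (0 : ℝ) ≤ riemannZetaZeroOrder ρ :=
            Int.cast_nonneg (riemannZetaZeroOrder_nonneg (ne_one_of_riemannZeta_eq_zero hz))
          have : 0 < ρ.im := hU0.trans_lt h3
          simp only [hw]; positivity
      _ ≤ Bk k := sum_inv_le_B₀_of_countRe hH2 hp0 hp1 hq0 (hN (σs k) hmem) hU (hT k hk)
  -- Step 1: the staircase bound, zero by zero
  have hstair : ∑ ρ ∈ S, (riemannZetaZeroOrder ρ : ℝ) * (x ^ (ρ.re - 1) / ρ.im) ≤
      ∑ ρ ∈ S, (a 1 + ∑ k ∈ Finset.Ico 1 N,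
        (if σs k ≤ ρ.re then a (k + 1) - a k else 0)) * w ρ := by
    refine Finset.sum_le_sum fun ρ hρ ↦ ?_
    have hρ' := hρ
    rw [hS, Finset.mem_filter] at hρ'
    obtain ⟨hρZ, hb1, hb2⟩ := hρ'
    have e : (riemannZetaZeroOrder ρ : ℝ) * (x ^ (ρ.re - 1) / ρ.im) = x ^ (ρ.re - 1) * w ρ := by
      simp only [hw]; ring
    rw [e]
    exact mul_le_mul_of_nonneg_right (FKS2023.rpow_le_staircase hN1 h12 hx hb1 hb2) (hw0 ρ hρZ)
  -- Step 2: exchange the sums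
  have hexch : ∑ ρ ∈ S, (a 1 + ∑ k ∈ Finset.Ico 1 N,
        (if σs k ≤ ρ.re then a (k + 1) - a k else 0)) * w ρ =
      a 1 * ∑ ρ ∈ S, w ρ +
        ∑ k ∈ Finset.Ico 1 N, (a (k + 1) - a k) * ∑ ρ ∈ S.filter (fun ρ ↦ σs k ≤ ρ.re), w ρ := by
    have e1 : ∀ ρ ∈ S, (a 1 + ∑ k ∈ Finset.Ico 1 N,
        (if σs k ≤ ρ.re then a (k + 1) - a k else 0)) * w ρ =
        a 1 * w ρ + ∑ k ∈ Finset.Ico 1 N, (if σs k ≤ ρ.re then (a (k + 1) - a k) * w ρ else 0) := by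
      intro ρ _
      rw [add_mul, Finset.sum_mul]
      congr 1
      refine Finset.sum_congr rfl fun k _ ↦ ?_
      split_ifs <;> simp
    rw [Finset.sum_congr rfl e1, Finset.sum_add_distrib, ← Finset.mul_sum, Finset.sum_comm]
    congr 1
    refine Finset.sum_congr rfl fun k _ ↦ ?_
    have e2 : (a (k + 1) - a k) * ∑ ρ ∈ S.filter (fun ρ ↦ σs k ≤ ρ.re), w ρ =
        ∑ ρ ∈ S, (if σs k ≤ ρ.re then (a (k + 1) - a k) * w ρ else 0) := by
      rw [Finset.sum_filter, Finset.mul_sum]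
      refine Finset.sum_congr rfl fun ρ _ ↦ ?_
      split_ifs <;> simp
    rw [e2]
  -- Step 3: bound the layer sums
  have hS0 : ∑ ρ ∈ S, w ρ ≤ Bk 0 := by
    have e : S.filter (fun ρ ↦ σs 0 ≤ ρ.re) = S := by
      ext ρ
      simp only [Finset.mem_filter, and_iff_left_iff_imp, hσs_val, Nat.cast_zero, mul_zero,
        zero_div, add_zero]
      intro hρ
      rw [hS, Finset.mem_filter] at hρ
      exact hρ.2.1
    have := hlayer 0 (by omega)
    rwa [e] at this
  have ha1 : 0 ≤ a 1 := by simp only [ha]; positivity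
  have hmain : ∑ ρ ∈ S, (riemannZetaZeroOrder ρ : ℝ) * (x ^ (ρ.re - 1) / ρ.im) ≤
      a 1 * Bk 0 + ∑ k ∈ Finset.Ico 1 N, (a (k + 1) - a k) * Bk k := by
    refine hstair.trans ?_
    rw [hexch]
    refine add_le_add (mul_le_mul_of_nonneg_left hS0 ha1) (Finset.sum_le_sum fun k hk ↦ ?_)
    rw [Finset.mem_Ico] at hk
    exact mul_le_mul_of_nonneg_left (hlayer k hk.2) (by linarith [ha_mono k])
  -- Step 4: identify with ε₃
  have hcoef : ∀ k : ℕ, a (k + 1) - a k =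
      x ^ (-(1 - σ₁)) * (1 - x ^ (-((σ₂ - σ₁) / N))) * x ^ ((σ₂ - σ₁) * (k + 1) / N) := by
    intro k
    simp only [ha, hσs_val]
    push_cast
    have e1 : σ₁ + (σ₂ - σ₁) * (k + 1) / N - 1 = -(1 - σ₁) + (σ₂ - σ₁) * (k + 1) / N := by ring
    have e2 : σ₁ + (σ₂ - σ₁) * k / N - 1 =
        -(1 - σ₁) + (σ₂ - σ₁) * (k + 1) / N + -((σ₂ - σ₁) / N) := by
      field_simp; ring
    rw [e1, e2, Real.rpow_add hx0, Real.rpow_add hx0, Real.rpow_add hx0]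
    ring
  have ha1' : a 1 = x ^ (-(1 - σ₁) + (σ₂ - σ₁) / N) := by
    simp only [ha, hσs_val]
    congr 1
    push_cast
    ring
  have hσ0 : σs 0 = σ₁ := by rw [hσs_val]; simp
  have hB0 : Bk 0 = FKS2023.B₀ (c₁ σ₁) (c₂ σ₁) (p σ₁) (q σ₁) (FKS2023.zfrHeight R σ₁) T := by
    simp only [hBk, hσ0]
  have e3 : ∑ k ∈ Finset.Ico 1 N, (a (k + 1) - a k) * Bk k =
      x ^ (-(1 - σ₁)) * (1 - x ^ (-((σ₂ - σ₁) / N))) *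
        ∑ k ∈ Finset.Ico 1 N, Bk k * x ^ ((σ₂ - σ₁) * (k + 1) / N) := by
    rw [Finset.mul_sum]
    refine Finset.sum_congr rfl fun k _ ↦ ?_
    rw [hcoef k]; ring
  rw [e3, hB0, ha1'] at hmain
  unfold FKS2023.zeroSumPsi FKS2023.ε₃
  rw [← hZ, ← hS]
  have hsum : ∑ n ∈ Finset.Ico 1 N,
      FKS2023.B₀ (c₁ (FKS2023.sigmaStep σ₁ σ₂ N n)) (c₂ (FKS2023.sigmaStep σ₁ σ₂ N n))
          (p (FKS2023.sigmaStep σ₁ σ₂ N n)) (q (FKS2023.sigmaStep σ₁ σ₂ N n))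
          (FKS2023.zfrHeight R (FKS2023.sigmaStep σ₁ σ₂ N n)) T
        * x ^ ((σ₂ - σ₁) * (n + 1) / N) =
      ∑ k ∈ Finset.Ico 1 N, Bk k * x ^ ((σ₂ - σ₁) * (k + 1) / N) := rfl
  rw [hsum]
  linarith

/-! ## Corollary 3.10: the trivial estimate `N = 1` -/

/-- **FKS Corollary 3.10, the trivial estimate** (proof of Cor. 3.10, first display: "Taking `N = 1`
in Prop. 3.8 we obtain `Σ_{σ₁}^{σ₂} < 2B₀(σ₁, H_{σ₁}, T) x^{σ₂−1}`"; PROVED): under the numerical-RH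
fact, a zero-free region `σ ≥ 1 − 1/(R log|t|)` (`|t| ≥ 2`, `R > 0`) and a (ZDB) majorant at `σ₁`
(`T' ≥ H₀`, `0 < p < 1`, `q > 0`), for `½ < σ₁`, any `σ₂` (the bound is used for `σ₁ ≤ σ₂ ≤ 1`),
`x ≥ 1` and `T ≥ H_{σ₁}`,
`Σ_{σ₁}^{σ₂}(x,T) ≤ 2 B₀(σ₁, H_{σ₁}, T) x^{σ₂−1}`. (The printed constant `0.00125994 x^{σ₂−1}` for
`σ₁ ≥ 0.9` is `2 lim_T B₀(0.9, H₀, T)` evaluated from the density table — a numerical evaluation of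
incomplete Gamma values, not reproduced here.) [cite: FioriKadiriSwidinsky2023, Cor. 3.10 (proof, first display)] -/
theorem FioriKadiriSwidinsky2023_cor310_trivial (hRH : platt_trudgian_numerical_rh) {R : ℝ}
    (hR : 0 < R)
    (hZFR : ∀ σ t : ℝ, 2 ≤ |t| → 1 - 1 / (R * Real.log |t|) ≤ σ → riemannZeta (σ + t * I) ≠ 0)
    {c₁ c₂ p q σ₁ σ₂ : ℝ} (hσ₁ : 1 / 2 < σ₁) (hp : 0 < p) (hp1 : p < 1) (hq : 0 < q)
    (hN : ∀ T' : ℝ, FKS2023.H₀ ≤ T' →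
      (zetaZeroCountRe σ₁ T' : ℝ) ≤ FKS2023.zdbMajorant c₁ c₂ p q T')
    {x T : ℝ} (hx : 1 ≤ x) (hT : FKS2023.zfrHeight R σ₁ ≤ T) :
    FKS2023.zeroSumPsi σ₁ σ₂ x T ≤
      2 * FKS2023.B₀ c₁ c₂ p q (FKS2023.zfrHeight R σ₁) T * x ^ (σ₂ - 1) := by
  classical
  have hx0 : 0 < x := by linarith
  have hH2 : (2 : ℝ) ≤ FKS2023.H₀ := by norm_num [FKS2023.H₀]
  have hU : FKS2023.H₀ ≤ FKS2023.zfrHeight R σ₁ := le_max_left _ _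
  have hU0 : 0 ≤ FKS2023.zfrHeight R σ₁ := le_trans (by norm_num [FKS2023.H₀]) hU
  unfold FKS2023.zeroSumPsi
  set S := (zerosBetween 0 T).filter (fun ρ ↦ σ₁ ≤ ρ.re ∧ ρ.re < σ₂) with hS
  set w : ℂ → ℝ := fun ρ ↦ (riemannZetaZeroOrder ρ : ℝ) * (1 / ρ.im) with hw
  -- the zeros of `S` lie in the window `(H_{σ₁}, T]` with `β ≥ σ₁`
  have hsub : S ⊆ zerosBetweenRe σ₁ (FKS2023.zfrHeight R σ₁) T := by
    intro ρ hρ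
    rw [hS, Finset.mem_filter, mem_zerosBetween le_rfl] at hρ
    obtain ⟨⟨hz, -, h1, him, hT'⟩, hσ, -⟩ := hρ
    have hre1 : ρ.re < 1 :=
      lt_of_le_of_ne h1 fun h ↦ riemannZeta_ne_zero_of_one_le_re (by rw [h]) hz
    have hσ1' : σ₁ < 1 := lt_of_le_of_lt hσ hre1
    exact (mem_zerosBetweenRe hU0).2
      ⟨hz, hσ, h1, FKS2023.zfrHeight_lt_im hRH hR hZFR hσ₁ hσ1' hz him hσ, hT'⟩
  -- zero by zero: `x^{β−1} ≤ x^{σ₂−1}`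
  have hterm : ∀ ρ ∈ S, (riemannZetaZeroOrder ρ : ℝ) * (x ^ (ρ.re - 1) / ρ.im) ≤
      x ^ (σ₂ - 1) * w ρ := by
    intro ρ hρ
    have hρ' := hρ
    rw [hS, Finset.mem_filter, mem_zerosBetween le_rfl] at hρ'
    obtain ⟨⟨hz, -, -, him, -⟩, -, hlt2⟩ := hρ'
    have hm : (0 : ℝ) ≤ riemannZetaZeroOrder ρ :=
      Int.cast_nonneg (riemannZetaZeroOrder_nonneg (ne_one_of_riemannZeta_eq_zero hz))
    have hpow : x ^ (ρ.re - 1) ≤ x ^ (σ₂ - 1) :=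
      Real.rpow_le_rpow_of_exponent_le hx (by linarith)
    have e : (riemannZetaZeroOrder ρ : ℝ) * (x ^ (ρ.re - 1) / ρ.im) = x ^ (ρ.re - 1) * w ρ := by
      simp only [hw]; ring
    rw [e]
    exact mul_le_mul_of_nonneg_right hpow (by simp only [hw]; positivity)
  have hw0 : ∀ ρ ∈ zerosBetweenRe σ₁ (FKS2023.zfrHeight R σ₁) T, 0 ≤ w ρ := by
    intro ρ hρ
    obtain ⟨hz, -, -, h3, -⟩ := (mem_zerosBetweenRe hU0).1 hρ
    have hm : (0 : ℝ) ≤ riemannZetaZeroOrder ρ :=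
      Int.cast_nonneg (riemannZetaZeroOrder_nonneg (ne_one_of_riemannZeta_eq_zero hz))
    have : 0 < ρ.im := hU0.trans_lt h3
    simp only [hw]; positivity
  have hB := sum_inv_le_B₀_of_countRe hH2 hp hp1 hq hN hU hT
  have hxpow : 0 ≤ x ^ (σ₂ - 1) := Real.rpow_nonneg hx0.le _
  calc 2 * ∑ ρ ∈ S, (riemannZetaZeroOrder ρ : ℝ) * (x ^ (ρ.re - 1) / ρ.im)
      ≤ 2 * ∑ ρ ∈ S, x ^ (σ₂ - 1) * w ρ :=
        mul_le_mul_of_nonneg_left (Finset.sum_le_sum hterm) (by norm_num)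
    _ = 2 * (x ^ (σ₂ - 1) * ∑ ρ ∈ S, w ρ) := by congr 1; rw [Finset.mul_sum]
    _ ≤ 2 * (x ^ (σ₂ - 1) * ∑ ρ ∈ zerosBetweenRe σ₁ (FKS2023.zfrHeight R σ₁) T, w ρ) :=
        mul_le_mul_of_nonneg_left (mul_le_mul_of_nonneg_left
          (Finset.sum_le_sum_of_subset_of_nonneg hsub fun ρ hρ _ ↦ hw0 ρ hρ) hxpow) (by norm_num)
    _ ≤ 2 * (x ^ (σ₂ - 1) * FKS2023.B₀ c₁ c₂ p q (FKS2023.zfrHeight R σ₁) T) :=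
        mul_le_mul_of_nonneg_left (mul_le_mul_of_nonneg_left (by simpa only [hw] using hB) hxpow)
          (by norm_num)
    _ = 2 * FKS2023.B₀ c₁ c₂ p q (FKS2023.zfrHeight R σ₁) T * x ^ (σ₂ - 1) := by ring

/-! ## Eq. (3.20): the limit of `B₀(σ, U, T)` as `T → ∞` -/

section B0Limit

open MeasureTheory Topology

/-- `Γ(s, y) → 0` as `y → ∞` (`s > 0`). [cite: DLMF, §8.2 eq. 8.2.2] -/
theorem tendsto_upperIncGamma_atTop {s : ℝ} (hs : 0 < s) :
    Tendsto (upperIncGamma s) atTop (𝓝 0) := by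
  set f : ℝ → ℝ := fun t ↦ t ^ (s - 1) * Real.exp (-t) with hf
  have hint := integrableOn_upperIncGamma_integrand hs le_rfl
  have h1 : Tendsto (fun y : ℝ ↦ ∫ t in (0 : ℝ)..y, f t) atTop (𝓝 (∫ t in Ioi 0, f t)) :=
    intervalIntegral_tendsto_integral_Ioi 0 hint tendsto_id
  have h2 : ∀ᶠ y : ℝ in atTop, upperIncGamma s 0 - ∫ t in (0 : ℝ)..y, f t = upperIncGamma s y := by
    filter_upwards [eventually_ge_atTop 0] with y hy
    rw [← upperIncGamma_sub hs le_rfl hy]; ring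
  have h3 := (tendsto_const_nhds (x := upperIncGamma s 0)).sub h1
  have h4 : upperIncGamma s 0 - ∫ t in Ioi 0, f t = 0 := by simp [upperIncGamma, hf]
  rw [h4] at h3
  exact h3.congr' h2

/-- **Eq. (3.20)** (proof of Cor. 3.10): `lim_{T→∞} B₀(σ₁, U, T) = c₁/(1−p)^{q+1} Γ(q+1, (1−p) log U)
+ c₂ Γ(3, log U)` (`p < 1`, `q > −1`; "noting that `lim_{T→∞} Γ(s,T) = 0`").
[cite: FioriKadiriSwidinsky2023, Cor. 3.10 (proof, eq. (3.20))] -/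
theorem FKS2023.tendsto_B₀_atTop {c₁ c₂ p q : ℝ} (hp1 : p < 1) (hq : 0 < q + 1) (U : ℝ) :
    Tendsto (fun V ↦ FKS2023.B₀ c₁ c₂ p q U V) atTop
      (𝓝 (c₁ / (1 - p) ^ (q + 1) * upperIncGamma (q + 1) ((1 - p) * Real.log U)
        + c₂ * upperIncGamma 3 (Real.log U))) := by
  have h1p : 0 < 1 - p := by linarith
  have hA : Tendsto (fun V : ℝ ↦ c₁ * Real.log V ^ q / V ^ (1 - p)) atTop (𝓝 0) := by
    have h := ((isLittleO_log_rpow_rpow_atTop q h1p).tendsto_div_nhds_zero).const_mul c₁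
    rw [mul_zero] at h
    exact h.congr fun V ↦ by ring
  have hB : Tendsto (fun V : ℝ ↦ c₂ * Real.log V ^ 2 / V) atTop (𝓝 0) := by
    have h := ((isLittleO_log_rpow_rpow_atTop (2 : ℝ) one_pos).tendsto_div_nhds_zero).const_mul c₂
    rw [mul_zero] at h
    refine h.congr fun V ↦ ?_
    rw [Real.rpow_two, Real.rpow_one]; ring
  have hΓ1 : Tendsto (fun V : ℝ ↦ upperIncGamma (q + 1) ((1 - p) * Real.log V)) atTop (𝓝 0) :=
    (tendsto_upperIncGamma_atTop hq).comp (Real.tendsto_log_atTop.const_mul_atTop h1p)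
  have hΓ2 : Tendsto (fun V : ℝ ↦ upperIncGamma 3 (Real.log V)) atTop (𝓝 0) :=
    (tendsto_upperIncGamma_atTop (by norm_num)).comp Real.tendsto_log_atTop
  have h := ((hA.add hB).add
    (((tendsto_const_nhds (x := upperIncGamma (q + 1) ((1 - p) * Real.log U))).sub hΓ1).const_mul
      (c₁ / (1 - p) ^ (q + 1)))).add
    (((tendsto_const_nhds (x := upperIncGamma 3 (Real.log U))).sub hΓ2).const_mul c₂)
  simp only [zero_add, sub_zero] at h
  simpa only [FKS2023.B₀] using h

/-- `Ñ` is non-decreasing on `[1, ∞)` for `c₁, c₂, p, q ≥ 0`. [cite: FioriKadiriSwidinsky2023, §2.2 eq. (2.6)] -/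
theorem FKS2023.zdbMajorant_mono {c₁ c₂ p q V W : ℝ} (hc₁ : 0 ≤ c₁) (hc₂ : 0 ≤ c₂) (hp : 0 ≤ p)
    (hq : 0 ≤ q) (hV : 1 ≤ V) (hVW : V ≤ W) :
    FKS2023.zdbMajorant c₁ c₂ p q V ≤ FKS2023.zdbMajorant c₁ c₂ p q W := by
  unfold FKS2023.zdbMajorant
  have hV0 : 0 < V := by linarith
  have hlogV : 0 ≤ Real.log V := Real.log_nonneg hV
  have hlog : Real.log V ≤ Real.log W := Real.log_le_log hV0 hVW
  have h1 : V ^ p ≤ W ^ p := Real.rpow_le_rpow hV0.le hVW hp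
  have h2 : Real.log V ^ q ≤ Real.log W ^ q := Real.rpow_le_rpow hlogV hlog hq
  have h3 : Real.log V ^ 2 ≤ Real.log W ^ 2 := pow_le_pow_left₀ hlogV hlog 2
  have h4 : 0 ≤ W ^ p := Real.rpow_nonneg (by linarith) _
  have h5 : 0 ≤ Real.log V ^ q := Real.rpow_nonneg hlogV _
  gcongr

/-- **`B₀(σ, U, ·)` is non-decreasing on `(1, ∞)`** (`c₁, c₂ ≥ 0`, `0 ≤ p < 1`, `q ≥ 0`): by the
closed form of the `J`-integrals, `B₀(U,W) − B₀(U,V) = Ñ(W)/W − Ñ(V)/V + ∫_V^W Ñ(t) dt/t²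
≥ (Ñ(W) − Ñ(V))/W ≥ 0`, `Ñ` being non-decreasing. [cite: FioriKadiriSwidinsky2023, Lemma 2.5 (proof)] -/
theorem FKS2023.B₀_mono_right {c₁ c₂ p q U V W : ℝ} (hc₁ : 0 ≤ c₁) (hc₂ : 0 ≤ c₂) (hp : 0 ≤ p)
    (hp1 : p < 1) (hq : 0 ≤ q) (hV : 1 < V) (hVW : V ≤ W) :
    FKS2023.B₀ c₁ c₂ p q U V ≤ FKS2023.B₀ c₁ c₂ p q U W := by
  have hV0 : 0 < V := by linarith
  have hW0 : 0 < W := by linarith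
  have hW1 : 1 < W := by linarith
  set Nt := FKS2023.zdbMajorant c₁ c₂ p q with hNt
  -- the two `J`-integrals on `[V, W]`
  have hI1 := integral_log_rpow_div_rpow hq (by linarith : (1 : ℝ) < 2 - p) hV hVW
  have hI2 := integral_log_rpow_div_rpow (by norm_num : (0 : ℝ) ≤ 2) (by norm_num : (1 : ℝ) < 2) hV hVW
  have e2 : (2 : ℝ) - 1 = 1 := by norm_num
  have e3 : (2 : ℝ) + 1 = 3 := by norm_num
  have e4 : (2 : ℝ) - p - 1 = 1 - p := by ring
  rw [e2, e3, one_mul, one_mul, Real.one_rpow, div_one] at hI2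
  rw [e4] at hI1
  -- `Ñ(t)/t` in the form appearing in `B₀`
  have eA : ∀ t : ℝ, 0 < t → Nt t / t = c₁ * Real.log t ^ q / t ^ (1 - p) + c₂ * Real.log t ^ 2 / t := by
    intro t ht
    simp only [hNt, FKS2023.zdbMajorant]
    have e1 : t ^ (1 - p) = t / t ^ p := by rw [Real.rpow_sub ht, Real.rpow_one]
    rw [e1]
    have htp : 0 < t ^ p := Real.rpow_pos_of_pos ht p
    field_simp
  -- pointwise minorant of the integrand on `[V, W]`: `Ñ(V) t^{-2} ≤ c₁ log^q t / t^{2-p} + c₂ log² t / t²`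
  have hpt : ∀ t ∈ Icc V W, Nt V * t ^ (-2 : ℝ) ≤
      c₁ * (Real.log t ^ q / t ^ (2 - p)) + c₂ * (Real.log t ^ (2 : ℝ) / t ^ (2 : ℝ)) := by
    intro t ht
    have ht0 : 0 < t := hV0.trans_le ht.1
    have ht1 : 1 ≤ t := hV.le.trans ht.1
    have hNle : Nt V ≤ Nt t := FKS2023.zdbMajorant_mono hc₁ hc₂ hp hq hV.le ht.1
    have ht2 : 0 < t ^ (-2 : ℝ) := Real.rpow_pos_of_pos ht0 _
    have e : c₁ * (Real.log t ^ q / t ^ (2 - p)) + c₂ * (Real.log t ^ (2 : ℝ) / t ^ (2 : ℝ)) =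
        Nt t * t ^ (-2 : ℝ) := by
      simp only [hNt, FKS2023.zdbMajorant]
      rw [Real.rpow_two, show (2 : ℝ) - p = -p + 2 by ring, Real.rpow_add ht0, Real.rpow_neg ht0.le,
        Real.rpow_two, show ((-2 : ℝ)) = -(2 : ℝ) by norm_num, Real.rpow_neg ht0.le, Real.rpow_two]
      have htp : 0 < t ^ p := Real.rpow_pos_of_pos ht0 p
      have ht2' : 0 < t ^ 2 := by positivity
      field_simp
    rw [e]
    exact mul_le_mul_of_nonneg_right hNle ht2.le
  -- integrate the minorant: `∫_V^W Ñ(V) t^{-2} = Ñ(V) (1/V − 1/W)`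
  have hint0 : ∫ t in V..W, Nt V * t ^ (-2 : ℝ) = Nt V * (1 / V - 1 / W) := by
    rw [intervalIntegral.integral_const_mul, integral_rpow (Or.inr ⟨by norm_num, ?_⟩)]
    · rw [show (-2 : ℝ) + 1 = -1 by norm_num, Real.rpow_neg_one, Real.rpow_neg_one]
      field_simp
      ring
    · rw [uIcc_of_le hVW]; exact fun h ↦ by linarith [h.1]
  -- integrability of both sides
  have hcont : ∀ (a b : ℝ), ContinuousOn (fun t : ℝ ↦ Real.log t ^ a / t ^ b) (Icc V W) := by
    intro a b t ht
    have ht0 : 0 < t := hV0.trans_le ht.1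
    have hlt : 0 < Real.log t := Real.log_pos (hV.trans_le ht.1)
    have hlog : ContinuousAt (fun s : ℝ ↦ Real.log s) t := Real.continuousAt_log ht0.ne'
    exact ((hlog.rpow_const (Or.inl hlt.ne')).div (Real.continuousAt_rpow_const _ _ (Or.inl ht0.ne'))
      (Real.rpow_pos_of_pos ht0 _).ne').continuousWithinAt
  have hi1 : IntervalIntegrable (fun t ↦ Real.log t ^ q / t ^ (2 - p)) volume V W :=
    (hcont q (2 - p)).intervalIntegrable_of_Icc hVW
  have hi2 : IntervalIntegrable (fun t ↦ Real.log t ^ (2 : ℝ) / t ^ (2 : ℝ)) volume V W :=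
    (hcont 2 2).intervalIntegrable_of_Icc hVW
  have hi0 : IntervalIntegrable (fun t : ℝ ↦ Nt V * t ^ (-2 : ℝ)) volume V W := by
    refine (ContinuousOn.intervalIntegrable_of_Icc hVW fun t ht ↦ ?_)
    have ht0 : 0 < t := hV0.trans_le ht.1
    exact (continuousAt_const.mul (Real.continuousAt_rpow_const _ _ (Or.inl ht0.ne'))).continuousWithinAt
  have hmono := intervalIntegral.integral_mono_on hVW hi0 ((hi1.const_mul c₁).add (hi2.const_mul c₂)) hpt
  rw [hint0, intervalIntegral.integral_add (hi1.const_mul c₁) (hi2.const_mul c₂),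
    intervalIntegral.integral_const_mul, intervalIntegral.integral_const_mul, hI1, hI2] at hmono
  -- `Ñ(W) ≥ Ñ(V)`
  have hNVW : Nt V ≤ Nt W := FKS2023.zdbMajorant_mono hc₁ hc₂ hp hq hV.le hVW
  have hNW : Nt V / W ≤ Nt W / W := div_le_div_of_nonneg_right hNVW hW0.le
  -- assemble
  have eBV := eA V hV0
  have eBW := eA W hW0
  have hmono' : Nt V / V - Nt V / W ≤
      c₁ / (1 - p) ^ (q + 1) * (upperIncGamma (q + 1) ((1 - p) * Real.log V) -
          upperIncGamma (q + 1) ((1 - p) * Real.log W))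
        + c₂ * (upperIncGamma 3 (Real.log V) - upperIncGamma 3 (Real.log W)) :=
    (le_of_eq (by ring)).trans (hmono.trans_eq (by ring))
  have hdiff : FKS2023.B₀ c₁ c₂ p q U W - FKS2023.B₀ c₁ c₂ p q U V =
      (Nt W / W - Nt V / V) +
        (c₁ / (1 - p) ^ (q + 1) * (upperIncGamma (q + 1) ((1 - p) * Real.log V) -
            upperIncGamma (q + 1) ((1 - p) * Real.log W))
          + c₂ * (upperIncGamma 3 (Real.log V) - upperIncGamma 3 (Real.log W))) := by
    rw [eBV, eBW]
    unfold FKS2023.B₀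
    ring
  have h0 : 0 ≤ FKS2023.B₀ c₁ c₂ p q U W - FKS2023.B₀ c₁ c₂ p q U V := by
    rw [hdiff]; linarith
  linarith

/-- **`B₀(σ, U, T) ≤ lim_{T→∞} B₀ = c₁/(1−p)^{q+1} Γ(q+1,(1−p) log U) + c₂ Γ(3, log U)`** for every
`T > 1` (`c₁, c₂ ≥ 0`, `0 ≤ p < 1`, `q ≥ 0`): the `T`-uniform form in which eq. (3.20) is used in
Cor. 3.10. [cite: FioriKadiriSwidinsky2023, Cor. 3.10 (proof, eq. (3.20))] -/
theorem FKS2023.B₀_le_lim {c₁ c₂ p q U T : ℝ} (hc₁ : 0 ≤ c₁) (hc₂ : 0 ≤ c₂) (hp : 0 ≤ p)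
    (hp1 : p < 1) (hq : 0 ≤ q) (hT : 1 < T) :
    FKS2023.B₀ c₁ c₂ p q U T ≤
      c₁ / (1 - p) ^ (q + 1) * upperIncGamma (q + 1) ((1 - p) * Real.log U)
        + c₂ * upperIncGamma 3 (Real.log U) := by
  refine ge_of_tendsto (FKS2023.tendsto_B₀_atTop hp1 (by linarith) U) ?_
  filter_upwards [eventually_ge_atTop T] with W hW
  exact FKS2023.B₀_mono_right hc₁ hc₂ hp hp1 hq hT hW

/-- **`s₀(σ, U, V) ≤ lim_T B₀(σ, U, T)` uniformly in `V`**: under a (ZDB) majorant for `T ≥ T₀`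
(`T₀ ≥ 2`, `c₁, c₂ ≥ 0`, `0 < p < 1`, `q > 0`), for `T₀ ≤ U ≤ V`,
`Σ_{β≥σ, U<γ≤V} m(ρ)/γ ≤ c₁/(1−p)^{q+1} Γ(q+1,(1−p) log U) + c₂ Γ(3, log U)` (Lemma 2.5 with the
`T`-uniform bound `B₀ ≤ lim B₀` of eq. (3.20)). [cite: FioriKadiriSwidinsky2023, Lemma 2.5 and Cor. 3.10 (proof, eq. (3.20))] -/
theorem sum_inv_le_B₀lim_of_countRe {σ T₀ c₁ c₂ p q U V : ℝ} (hT₀ : 2 ≤ T₀) (hc₁ : 0 ≤ c₁)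
    (hc₂ : 0 ≤ c₂) (hp : 0 < p) (hp1 : p < 1) (hq : 0 < q)
    (hN : ∀ T : ℝ, T₀ ≤ T → (zetaZeroCountRe σ T : ℝ) ≤ FKS2023.zdbMajorant c₁ c₂ p q T)
    (hU : T₀ ≤ U) (hUV : U ≤ V) :
    ∑ ρ ∈ zerosBetweenRe σ U V, (riemannZetaZeroOrder ρ : ℝ) * (1 / ρ.im) ≤
      c₁ / (1 - p) ^ (q + 1) * upperIncGamma (q + 1) ((1 - p) * Real.log U)
        + c₂ * upperIncGamma 3 (Real.log U) :=
  (sum_inv_le_B₀_of_countRe hT₀ hp hp1 hq hN hU hUV).trans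
    (FKS2023.B₀_le_lim hc₁ hc₂ hp.le hp1 hq.le (by linarith))

/-- **FKS Corollary 3.10, uniformly in `T`** (the printed form `Σ_{σ₁}^{σ₂} ≤ 2·lim_T B₀(σ₁,H_{σ₁},T)·x^{σ₂−1}`,
with the limit (3.20) in closed form; the printed number `0.00125994` is this constant for `σ₁ = 0.9`
and FKS's density values, not reproduced): under the hypotheses of
`FioriKadiriSwidinsky2023_cor310_trivial` with `c₁, c₂ ≥ 0`, for every `T ≥ H_{σ₁}`,
`Σ_{σ₁}^{σ₂}(x,T) ≤ 2 (c₁/(1−p)^{q+1} Γ(q+1,(1−p) log H_{σ₁}) + c₂ Γ(3, log H_{σ₁})) x^{σ₂−1}`.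
[cite: FioriKadiriSwidinsky2023, Cor. 3.10] -/
theorem FioriKadiriSwidinsky2023_cor310 (hRH : platt_trudgian_numerical_rh) {R : ℝ} (hR : 0 < R)
    (hZFR : ∀ σ t : ℝ, 2 ≤ |t| → 1 - 1 / (R * Real.log |t|) ≤ σ → riemannZeta (σ + t * I) ≠ 0)
    {c₁ c₂ p q σ₁ σ₂ : ℝ} (hσ₁ : 1 / 2 < σ₁) (hc₁ : 0 ≤ c₁) (hc₂ : 0 ≤ c₂) (hp : 0 < p)
    (hp1 : p < 1) (hq : 0 < q)
    (hN : ∀ T' : ℝ, FKS2023.H₀ ≤ T' →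
      (zetaZeroCountRe σ₁ T' : ℝ) ≤ FKS2023.zdbMajorant c₁ c₂ p q T')
    {x T : ℝ} (hx : 1 ≤ x) (hT : FKS2023.zfrHeight R σ₁ ≤ T) :
    FKS2023.zeroSumPsi σ₁ σ₂ x T ≤
      2 * (c₁ / (1 - p) ^ (q + 1) * upperIncGamma (q + 1) ((1 - p) * Real.log (FKS2023.zfrHeight R σ₁))
        + c₂ * upperIncGamma 3 (Real.log (FKS2023.zfrHeight R σ₁))) * x ^ (σ₂ - 1) := by
  have hH1 : (1 : ℝ) < FKS2023.zfrHeight R σ₁ :=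
    lt_of_lt_of_le (by norm_num [FKS2023.H₀]) (le_max_left _ _)
  have hlim := FKS2023.B₀_le_lim (U := FKS2023.zfrHeight R σ₁) hc₁ hc₂ hp.le hp1 hq.le (hH1.trans_le hT)
  have hxpow : 0 ≤ x ^ (σ₂ - 1) := Real.rpow_nonneg (by linarith) _
  refine (FioriKadiriSwidinsky2023_cor310_trivial hRH hR hZFR hσ₁ hp hp1 hq hN hx hT).trans ?_
  exact mul_le_mul_of_nonneg_right (mul_le_mul_of_nonneg_left hlim (by norm_num)) hxpow

end B0Limit

end Literature.NumberTheory.LFunctions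

end
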